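import Literature.NumberTheory.NumberFields.RayClassFieldAdicCharacterTower
import Mathlib.NumberTheory.Padics.RingHoms
import Mathlib.LinearAlgebra.FreeModule.IdealQuotient
import HarnessLib

/-!
# The DIVISION TWISTS of de Shalit II.4.12 EXIST: principal `𝔞₁ = (α₁)`, `𝔞₂ = (σα₁)` with `αᵢ ≡ 1 mod 𝔪`, `v(α₁ − 1) = 2` exactly,
# `σα₁ ≡ 1 mod v³`, `(σα₁)ᵏ ≠ α₁ᵏ` in `K_v`, `N𝔞₁ = N𝔞₂ ≥ 2`, `4 ∣ N𝔞₁ − 1` — the arithmetic inputs of `…EllipticUnitsLocalMeasurePrincipal`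

Cell `bsd-print-cf2`, width seat `bsd-line-cf2c-w4` g10; `--supports` stmt-BirchSwinnertonDyer-24721 (helper, Theses-free). THEOREMS ONLY;
no named facts.

`exists_groupDistribution_twisting_eq_induce_ellipticUnitsLocal_of_principal` (p749243) reduced the division data of the one-`𝔓` measure of
de Shalit II.4.12 to elementary arithmetic of two principal twists `(α₁), (α₂)`: `αᵢ − 1 ∈ 𝔪`, `α₁ − 1 ∈ v^{s+1} ∖ v^{s+2}` (`s ≥ 1`),
`α₂ − 1 ∈ v^{s+1}`, `α₂ᵏ ≠ α₁ᵏ` in `K_v` (`k > 0`), `N(α₁) = N(α₂) ≥ 2`, `4 ∣ N(α₁) − 1`.  De Shalit (II.4.12, p. 66–68) takes `𝔞₂ = 𝔞̄₁`;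
THIS file constructs such a pair with `s = 1` for any involution `σ` of `𝒪_K` (complex conjugation of an imaginary quadratic `K`) preserving
`𝔪`, a prime `v' ≠ v` with `σ(v') ⊆ v` (`v' = v̄`, `2 = v v̄` split), `𝒪_v ≅ ℤ₂`, `w_𝔪 = 1`, `v ∤ 𝔪`, and the norm form `N(a) = a·σa`:
`α₁ := 1 + x` with `x ∈ 𝔪 ∩ v̄³ ∩ v² ∖ v³` (three elements multiplied; no Chinese remainder theorem needed) and `α₂ := σα₁ = 1 + σx`,
`σx ∈ v³`.  The inequality `α₂ᵏ ≠ α₁ᵏ` is 2-adic: `2² ∥ e(α₁) − 1`, `2³ ∣ e(α₂) − 1` in `ℤ₂`, and `v₂(aᵏ − 1) = 2 + v₂(k)` exactly for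
`a ∈ 1 + 4ℤ₂ ∖ 1 + 8ℤ₂` (the lifting-the-exponent step at `p = 2`, valid inside `1 + 4ℤ₂` — de Shalit's II.4.17 `1 + 4ℤ₂`).

* §1 (in `ℤ₂`) `two_pow_dvd_pow_sub_one`, `two_pow_succ_dvd_sq_sub_one`, `not_two_pow_succ_dvd_pow_sub_one_of_odd`,
  `not_two_pow_add_two_dvd_sq_sub_one`, `exact_pow_two_pow`, ★ `pow_ne_pow_of_two_adic` (`2² ∥ a − 1`, `2³ ∣ b − 1 ⟹ aᵏ ≠ bᵏ`);
* §2 (reading `𝒪_K` in `ℤ₂` along `e₂ ∘ (𝒪_K → 𝒪_v)`) `toPadicInt`, `coe_algebraMap_ringOfIntegers`, ★ `mem_pow_iff_two_pow_dvd_toPadicInt`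
  (`y ∈ vⁿ ↔ 2ⁿ ∣ e₂(y)`), `toPadicInt_pow_eq_of_coe_pow_eq`, `four_dvd_of_intCast_mem_sq`;
* §3 `exists_mem_mem_sq_not_mem_cube` (the element `x`), `isCoprime_span_singleton_of_sub_one_mem`, and ★★★ `exists_divisionTwists` — **the
  pair `(α₁, α₂)` with ALL the arithmetic hypotheses of `…_of_principal` for `s = 1`** (plus `αᵢ ≠ 0` and `((αᵢ), 𝔪v) = 1` for the twist family).

HONEST FRAMING: elementary; nothing here closes a crux; no summit statement is proved; BSD is not proved by any of this.

## References
* [deShalit1987] E. de Shalit, *Iwasawa theory of elliptic curves with complex multiplication* (1987), II.4.12 (p. 66–69), II.4.17 (p. 77–78).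
* [NeukirchANT1999] J. Neukirch, *Algebraic Number Theory* (1999), Ch. I §3, Ch. II §4–§5.
-/

-- the summit namespace `Summit.BirchSwinnertonDyer.BirchSwinnertonDyer` repeats the problem name by design (D-0017)
set_option linter.dupNamespace false
set_option autoImplicit false

noncomputable section

open scoped Classical nonZeroDivisors NumberField
open IsDedekindDomain IsDedekindDomain.HeightOneSpectrum Finset
open Literature.NumberTheory.NumberFields

namespace Summit.BirchSwinnertonDyer.BirchSwinnertonDyer.Theorems.PrintCf2.EllipticUnitsLocal

/-! ## §1. The 2-adic inequality: `2² ∥ a − 1`, `2³ ∣ b − 1 ⟹ aᵏ ≠ bᵏ` -/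

section TwoAdic

/-- `2` is not a unit of `ℤ₂`. [folklore] -/
theorem two_not_isUnit : ¬ IsUnit (2 : ℤ_[2]) := by
  have h := (PadicInt.irreducible_p (p := 2)).not_isUnit
  exact_mod_cast h

/-- `2` is prime in `ℤ₂`. [folklore] -/
theorem two_prime : Prime (2 : ℤ_[2]) := by
  have h := PadicInt.prime_p (p := 2)
  exact_mod_cast h

/-- `2 ∤ m` in `ℤ₂` for `m` odd. [folklore] -/
theorem not_two_dvd_natCast_of_odd {m : ℕ} (hm : Odd m) : ¬ (2 : ℤ_[2]) ∣ (m : ℤ_[2]) := by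
  obtain ⟨q, rfl⟩ := hm
  rintro ⟨c, hc⟩
  apply two_not_isUnit
  refine isUnit_of_dvd_one ⟨c - q, ?_⟩
  push_cast at hc
  linear_combination hc

/-- `2^t ∣ c − 1 ⟹ 2^t ∣ c^m − 1`. [folklore] -/
theorem two_pow_dvd_pow_sub_one {c : ℤ_[2]} {t : ℕ} (h : (2 : ℤ_[2]) ^ t ∣ c - 1) (m : ℕ) :
    (2 : ℤ_[2]) ^ t ∣ c ^ m - 1 :=
  h.trans (by simpa only [one_pow] using sub_dvd_pow_sub_pow c 1 m)

/-- `2^t ∣ c − 1`, `t ≥ 1` ⟹ `2^{t+1} ∣ c² − 1`. [folklore] -/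
theorem two_pow_succ_dvd_sq_sub_one {c : ℤ_[2]} {t : ℕ} (ht : 1 ≤ t) (h : (2 : ℤ_[2]) ^ t ∣ c - 1) :
    (2 : ℤ_[2]) ^ (t + 1) ∣ c ^ 2 - 1 := by
  have h2 : (2 : ℤ_[2]) ∣ c + 1 := by
    have h1 : (2 : ℤ_[2]) ∣ c - 1 := (dvd_pow_self 2 (by omega : t ≠ 0)).trans h
    have : c + 1 = (c - 1) + 2 := by ring
    rw [this]; exact dvd_add h1 (dvd_refl 2)
  have : c ^ 2 - 1 = (c - 1) * (c + 1) := by ring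
  rw [this, pow_succ]
  exact mul_dvd_mul h h2

/-- `2^t ∣ c − 1`, `t ≥ 1` ⟹ `2^{t+j} ∣ c^{2^j} − 1`. [folklore] -/
theorem two_pow_add_dvd_pow_two_pow_sub_one {c : ℤ_[2]} {t : ℕ} (ht : 1 ≤ t) (h : (2 : ℤ_[2]) ^ t ∣ c - 1) (j : ℕ) :
    (2 : ℤ_[2]) ^ (t + j) ∣ c ^ (2 ^ j) - 1 := by
  induction j with
  | zero => simpa using h
  | succ j ih =>
    have h' := two_pow_succ_dvd_sq_sub_one (c := c ^ 2 ^ j) (by omega) ih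
    rw [← pow_mul, ← pow_succ] at h'
    simpa only [Nat.add_assoc] using h'

/-- Exactness under odd powers: `2^t ∥ c − 1` (`t ≥ 1`), `m` odd ⟹ `2^{t+1} ∤ c^m − 1` (`c^m − 1 = (c−1)·Σ c^i`, `Σ_{i<m} c^i ≡ m` odd). [folklore] -/
theorem not_two_pow_succ_dvd_pow_sub_one_of_odd {c : ℤ_[2]} {t : ℕ} (ht : 1 ≤ t) (h : (2 : ℤ_[2]) ^ t ∣ c - 1)
    (h' : ¬ (2 : ℤ_[2]) ^ (t + 1) ∣ c - 1) {m : ℕ} (hm : Odd m) : ¬ (2 : ℤ_[2]) ^ (t + 1) ∣ c ^ m - 1 := by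
  intro hdvd
  -- `c^m − 1 = (Σ_{i<m} c^i) (c − 1)` with `Σ c^i ≡ m` odd
  have h1 : (2 : ℤ_[2]) ∣ c - 1 := (dvd_pow_self 2 (by omega : t ≠ 0)).trans h
  have hg : ¬ (2 : ℤ_[2]) ∣ ∑ i ∈ range m, c ^ i := by
    intro hg
    have hsum : (2 : ℤ_[2]) ∣ ∑ i ∈ range m, c ^ i - (m : ℤ_[2]) := by
      have : ∑ i ∈ range m, c ^ i - (m : ℤ_[2]) = ∑ i ∈ range m, (c ^ i - 1) := by
        rw [Finset.sum_sub_distrib, Finset.sum_const, card_range, nsmul_eq_mul, mul_one]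
      rw [this]
      exact Finset.dvd_sum fun i _ ↦ h1.trans (by simpa only [one_pow] using sub_dvd_pow_sub_pow c 1 i)
    have : (2 : ℤ_[2]) ∣ (m : ℤ_[2]) := by
      have := dvd_sub hg hsum; rwa [sub_sub_cancel] at this
    exact not_two_dvd_natCast_of_odd hm this
  rw [← geom_sum_mul] at hdvd
  exact h' (two_prime.pow_dvd_of_dvd_mul_left (t + 1) hg hdvd)

/-- Exactness under squaring: `2^t ∥ c − 1` with `t ≥ 2` ⟹ `2^{t+2} ∤ c² − 1` (`c + 1 = 2·odd`) — the `p = 2` step of the lifting-the-exponent lemma, valid from `t = 2` on (de Shalit's `1 + 4ℤ₂`). [cite: deShalit1987, II.4.17 (p. 78)] -/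
theorem not_two_pow_add_two_dvd_sq_sub_one {c : ℤ_[2]} {t : ℕ} (ht : 2 ≤ t) (h : (2 : ℤ_[2]) ^ t ∣ c - 1)
    (h' : ¬ (2 : ℤ_[2]) ^ (t + 1) ∣ c - 1) : ¬ (2 : ℤ_[2]) ^ (t + 2) ∣ c ^ 2 - 1 := by
  intro hdvd
  have h4 : (2 : ℤ_[2]) ^ 2 ∣ c - 1 := (pow_dvd_pow 2 ht).trans h
  -- `c + 1 = (c − 1) + 2 = 2 w` with `w` odd
  have hw : ¬ (2 : ℤ_[2]) ^ 2 ∣ c + 1 := by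
    intro h2
    have : (2 : ℤ_[2]) ^ 2 ∣ (c + 1) - (c - 1) := dvd_sub h2 h4
    rw [show (c + 1) - (c - 1) = (2 : ℤ_[2]) by ring] at this
    obtain ⟨d, hd⟩ := this
    apply two_not_isUnit
    have h21 : (2 : ℤ_[2]) * 1 = 2 * (2 * d) := by rw [mul_one, ← mul_assoc, ← pow_two]; exact hd
    exact isUnit_of_dvd_one ⟨d, mul_left_cancel₀ two_ne_zero h21⟩
  have h2 : (2 : ℤ_[2]) ∣ c + 1 := by
    have h1 : (2 : ℤ_[2]) ∣ c - 1 := (dvd_pow_self 2 (by omega : t ≠ 0)).trans h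
    rw [show c + 1 = (c - 1) + 2 by ring]; exact dvd_add h1 (dvd_refl 2)
  obtain ⟨w, hcw⟩ := h2
  have hwodd : ¬ (2 : ℤ_[2]) ∣ w := by
    rintro ⟨w', rfl⟩; exact hw ⟨w', by rw [hcw]; ring⟩
  rw [show c ^ 2 - 1 = (c - 1) * (c + 1) by ring, hcw, show t + 2 = (t + 1) + 1 by ring, pow_succ] at hdvd
  -- `2^{t+1}·2 ∣ (c − 1)·(2 w)` ⟹ `2^{t+1} ∣ (c − 1) w` ⟹ `2^{t+1} ∣ c − 1`
  have h3 : (2 : ℤ_[2]) ^ (t + 1) ∣ (c - 1) * w := by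
    rw [show (c - 1) * (2 * w) = ((c - 1) * w) * 2 by ring] at hdvd
    exact (mul_dvd_mul_iff_right (two_ne_zero)).mp hdvd
  exact h' (two_prime.pow_dvd_of_dvd_mul_right (t + 1) hwodd h3)

/-- Iterated: `2² ∥ c − 1 ⟹ 2^{2+j} ∥ c^{2^j} − 1`. [cite: deShalit1987, II.4.17 (p. 78)] -/
theorem exact_pow_two_pow {c : ℤ_[2]} (h : (2 : ℤ_[2]) ^ 2 ∣ c - 1) (h' : ¬ (2 : ℤ_[2]) ^ 3 ∣ c - 1) (j : ℕ) :
    (2 : ℤ_[2]) ^ (2 + j) ∣ c ^ (2 ^ j) - 1 ∧ ¬ (2 : ℤ_[2]) ^ (2 + j + 1) ∣ c ^ (2 ^ j) - 1 := by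
  induction j with
  | zero => exact ⟨by simpa using h, by simpa using h'⟩
  | succ j ih =>
    obtain ⟨h1, h2⟩ := ih
    refine ⟨?_, ?_⟩
    · have := two_pow_succ_dvd_sq_sub_one (c := c ^ 2 ^ j) (by omega) h1
      rw [← pow_mul, ← pow_succ] at this
      simpa only [Nat.add_assoc] using this
    · have := not_two_pow_add_two_dvd_sq_sub_one (c := c ^ 2 ^ j) (by omega) h1 h2
      rw [← pow_mul, ← pow_succ] at this
      exact this

/-- ★ **`2² ∥ a − 1` and `2³ ∣ b − 1` ⟹ `a^k ≠ b^k` for every `k > 0`** (`v₂(a^k − 1) = 2 + v₂(k) < 3 + v₂(k) ≤ v₂(b^k − 1)`): the 2-adic heart of the hypothesis `hτ`/`hne` of de Shalit's division step for `σ_{𝔞₂}^k σ_{𝔞₁}^{-k} ≠ 1`. [cite: deShalit1987, II.4.12 (p. 67–68), II.4.17 (p. 78)] -/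
theorem pow_ne_pow_of_two_adic {a b : ℤ_[2]} (ha : (2 : ℤ_[2]) ^ 2 ∣ a - 1) (ha' : ¬ (2 : ℤ_[2]) ^ 3 ∣ a - 1)
    (hb : (2 : ℤ_[2]) ^ 3 ∣ b - 1) {k : ℕ} (hk : 0 < k) : a ^ k ≠ b ^ k := by
  obtain ⟨j, m, hm, rfl⟩ := Nat.exists_eq_two_pow_mul_odd hk.ne'
  intro heq
  -- `a^{2^j m} = (a^m)^{2^j}` with `2² ∥ a^m − 1`
  have ham : (2 : ℤ_[2]) ^ 2 ∣ a ^ m - 1 := two_pow_dvd_pow_sub_one ha m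
  have ham' : ¬ (2 : ℤ_[2]) ^ 3 ∣ a ^ m - 1 := not_two_pow_succ_dvd_pow_sub_one_of_odd (by norm_num) ha ha' hm
  obtain ⟨-, hak⟩ := exact_pow_two_pow ham ham' j
  have hbk : (2 : ℤ_[2]) ^ (3 + j) ∣ (b ^ m) ^ (2 ^ j) - 1 :=
    two_pow_add_dvd_pow_two_pow_sub_one (by norm_num) (two_pow_dvd_pow_sub_one hb m) j
  have e1 : (b ^ m) ^ 2 ^ j = (a ^ m) ^ 2 ^ j := by rw [← pow_mul, ← pow_mul, mul_comm m, ← heq]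
  rw [e1] at hbk
  rw [show 2 + j + 1 = 3 + j by omega] at hak
  exact hak hbk
end TwoAdic

/-! ## §2. Reading `𝒪_K` in `ℤ₂` along `e₂ ∘ (𝒪_K → 𝒪_v)` -/

section Reading

variable {K : Type} [Field K] [NumberField K] {v : HeightOneSpectrum (𝓞 K)}

/-- `𝒪_K → ℤ₂` along `e₂ : 𝒪_v ≅ ℤ₂`. (Abbreviation inside statements: `(e₂ : 𝒪_v →+* ℤ₂) ∘ algebraMap 𝒪_K 𝒪_v`.) [cite: deShalit1987, II.1.1 (p. 32)] -/
theorem toPadicInt_intCast (e₂ : v.adicCompletionIntegers K ≃+* ℤ_[2]) (n : ℤ) :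
    ((e₂ : v.adicCompletionIntegers K →+* ℤ_[2]).comp (algebraMap (𝓞 K) (v.adicCompletionIntegers K))) (n : 𝓞 K) = (n : ℤ_[2]) :=
  map_intCast _ n

/-- `(algebraMap 𝒪_K 𝒪_v y : K_v) = ((y : K) : K_v)`. [folklore] -/
theorem coe_algebraMap_ringOfIntegers (y : 𝓞 K) :
    ((algebraMap (𝓞 K) (v.adicCompletionIntegers K) y : v.adicCompletionIntegers K) : v.adicCompletion K) =
      ((y : K) : v.adicCompletion K) := by
  rw [algebraMap_adicCompletionIntegers_apply]

/-- ★ **`y ∈ vⁿ ↔ 2ⁿ ∣ e₂(y)`**: membership in powers of `v` read in `ℤ₂` (cf2c-w4 g8's `toZModPow_map_eq_zero_iff_valued`).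
[cite: deShalit1987, II.1.9 (p. 43)] -/
theorem mem_pow_iff_two_pow_dvd_toPadicInt (e₂ : v.adicCompletionIntegers K ≃+* ℤ_[2]) (y : 𝓞 K) (n : ℕ) :
    y ∈ v.asIdeal ^ n ↔ (2 : ℤ_[2]) ^ n ∣
      ((e₂ : v.adicCompletionIntegers K →+* ℤ_[2]).comp (algebraMap (𝓞 K) (v.adicCompletionIntegers K))) y := by
  rw [← intValuation_le_pow_iff_mem, ← valuation_of_algebraMap (K := K), ← valuedAdicCompletion_eq_valuation',
    show ((algebraMap (𝓞 K) K y : K) : v.adicCompletion K) =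
      ((algebraMap (𝓞 K) (v.adicCompletionIntegers K) y : v.adicCompletionIntegers K) : v.adicCompletion K) from
      (coe_algebraMap_ringOfIntegers y).symm,
    ← toZModPow_map_eq_zero_iff_valued e₂ n, ← RingHom.mem_ker, PadicInt.ker_toZModPow, Ideal.mem_span_singleton, Nat.cast_ofNat]
  rfl

/-- Equal `k`-th powers in `K_v` of two integers of `K` have equal `k`-th powers in `ℤ₂`. [folklore] -/
theorem toPadicInt_pow_eq_of_coe_pow_eq (e₂ : v.adicCompletionIntegers K ≃+* ℤ_[2]) {a b : 𝓞 K} {k : ℕ}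
    (h : ((a : K) : v.adicCompletion K) ^ k = ((b : K) : v.adicCompletion K) ^ k) :
    ((e₂ : v.adicCompletionIntegers K →+* ℤ_[2]).comp (algebraMap (𝓞 K) (v.adicCompletionIntegers K))) a ^ k =
      ((e₂ : v.adicCompletionIntegers K →+* ℤ_[2]).comp (algebraMap (𝓞 K) (v.adicCompletionIntegers K))) b ^ k := by
  have h' : (algebraMap (𝓞 K) (v.adicCompletionIntegers K) a) ^ k = (algebraMap (𝓞 K) (v.adicCompletionIntegers K) b) ^ k := by
    apply Subtype.ext
    rw [SubmonoidClass.coe_pow, SubmonoidClass.coe_pow, coe_algebraMap_ringOfIntegers, coe_algebraMap_ringOfIntegers]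
    exact h
  have h'' := congrArg (e₂ : v.adicCompletionIntegers K →+* ℤ_[2]) h'
  simpa only [RingHom.comp_apply, map_pow] using h''

/-- `(n : 𝒪_K) ∈ v² ⟹ 4 ∣ n` for an integer `n` (`𝒪_v ≅ ℤ₂`: `v² ∩ ℤ = 4ℤ`). [cite: NeukirchANT1999, Ch. II §5] -/
theorem four_dvd_of_intCast_mem_sq (e₂ : v.adicCompletionIntegers K ≃+* ℤ_[2]) {n : ℤ} (h : ((n : 𝓞 K)) ∈ v.asIdeal ^ 2) :
    (4 : ℤ) ∣ n := by
  rw [mem_pow_iff_two_pow_dvd_toPadicInt e₂, toPadicInt_intCast] at h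
  have h0 : PadicInt.toZModPow 2 ((n : ℤ_[2])) = 0 := by
    rw [← RingHom.mem_ker, PadicInt.ker_toZModPow, Ideal.mem_span_singleton, Nat.cast_ofNat]; exact h
  rw [map_intCast, ZMod.intCast_zmod_eq_zero_iff_dvd] at h0
  exact_mod_cast h0

end Reading

/-! ## §3. The division twists -/

section Twists

variable {K : Type} [Field K] [NumberField K] {𝔪 : Ideal (𝓞 K)} {v v' : HeightOneSpectrum (𝓞 K)}

/-- `x ∉ v ⟹ v(x) = 1` (integral valuation). [folklore] -/
theorem intValuation_eq_one_of_not_mem {x : 𝓞 K} (hx : x ∉ v.asIdeal) : v.intValuation x = 1 := by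
  refine le_antisymm (v.intValuation_le_one x) (not_lt.mp fun h ↦ hx ?_)
  rw [intValuation_lt_one_iff_dvd, Ideal.dvd_span_singleton] at h
  exact h

/-- **The element `x ∈ 𝔪 ∩ v'³ ∩ v² ∖ v³`** (`v ∤ 𝔪`, `v' ≠ v`): a product of `x₁ ∈ 𝔪 ∖ v`, `x₂ ∈ v'³ ∖ v`, `x₃ ∈ v² ∖ v³`.
[cite: NeukirchANT1999, Ch. I §3 (3.1)] -/
theorem exists_mem_mem_sq_not_mem_cube (hv : ¬ 𝔪 ≤ v.asIdeal) (hv' : v' ≠ v) :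
    ∃ x : 𝓞 K, x ∈ 𝔪 ∧ x ∈ v'.asIdeal ^ 3 ∧ x ∈ v.asIdeal ^ 2 ∧ x ∉ v.asIdeal ^ 3 := by
  obtain ⟨x₁, hx₁𝔪, hx₁v⟩ := Set.not_subset.mp hv
  have hv'3 : ¬ v'.asIdeal ^ 3 ≤ v.asIdeal := fun h ↦
    hv' (HeightOneSpectrum.ext (v'.isMaximal.eq_of_le v.isPrime.ne_top (v.isPrime.le_of_pow_le h)).symm).symm
  obtain ⟨x₂, hx₂v', hx₂v⟩ := Set.not_subset.mp hv'3
  obtain ⟨x₃, hx₃, hx₃'⟩ := v.asIdeal.exists_mem_pow_notMem_pow_succ v.ne_bot v.isPrime.ne_top 2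
  refine ⟨x₁ * x₂ * x₃, 𝔪.mul_mem_right _ (𝔪.mul_mem_right _ hx₁𝔪),
    Ideal.mul_mem_right _ _ (Ideal.mul_mem_left _ _ hx₂v'), Ideal.mul_mem_left _ _ hx₃, fun h ↦ hx₃' ?_⟩
  rw [← intValuation_le_pow_iff_mem, map_mul, map_mul, intValuation_eq_one_of_not_mem hx₁v,
    intValuation_eq_one_of_not_mem hx₂v, one_mul, one_mul, intValuation_le_pow_iff_mem] at h
  exact h

omit [NumberField K] in
/-- `α ≡ 1 mod I ⟹ ((α), I) = 1`. [folklore] -/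
theorem isCoprime_span_singleton_of_sub_one_mem {α : 𝓞 K} {I : Ideal (𝓞 K)} (h : α - 1 ∈ I) :
    IsCoprime (Ideal.span {α}) I :=
  Ideal.isCoprime_iff_exists.mpr ⟨α, Ideal.mem_span_singleton_self α, -(α - 1), I.neg_mem h, by ring⟩

variable [NumberField.IsTotallyComplex K]

omit [NumberField.IsTotallyComplex K] in
/-- ★★★ **The division twists exist.**  Let `σ` be an involution of `𝒪_K` preserving `𝔪` with `N(a) = a·σa` (the norm form of an
imaginary quadratic `K` under complex conjugation), `v' ≠ v` a prime with `σ(v') ⊆ v` (`v' = v̄`), `𝒪_v ≅ ℤ₂`, `v ∤ 𝔪`, `w_𝔪 = 1`.  Then there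
are `α₁, α₂ = σα₁ ∈ 𝒪_K`, non-zero, `≡ 1 mod 𝔪`, `((αᵢ), 𝔪v) = 1`, with `α₁ − 1 ∈ v² ∖ v³`, `α₂ − 1 ∈ v²`, `α₂ᵏ ≠ α₁ᵏ` in `K_v` for all
`k > 0`, `N(α₁) ≥ 2`, `4 ∣ N(α₁) − 1`, `N(α₂) = N(α₁)` — ALL the arithmetic hypotheses (`s = 1`) of
`exists_groupDistribution_twisting_eq_induce_ellipticUnitsLocal_of_principal` (de Shalit's `𝔞₁`, `𝔞₂ = 𝔞̄₁` with `σ_{𝔞₁}` a topological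
generator of `Gal(K(𝔣𝔭^∞)/K(𝔣𝔭))`, inside `1 + 4ℤ₂`). [cite: deShalit1987, II.4.12 (p. 66–68), II.4.17 (p. 78)] -/
theorem exists_divisionTwists (hv : ¬ 𝔪 ≤ v.asIdeal) (hw : ∀ u : (𝓞 K)ˣ, (u : 𝓞 K) - 1 ∈ 𝔪 → u = 1)
    (e₂ : v.adicCompletionIntegers K ≃+* ℤ_[2]) (σ : 𝓞 K ≃+* 𝓞 K) (hσσ : ∀ a, σ (σ a) = a) (h𝔪σ : ∀ y ∈ 𝔪, σ y ∈ 𝔪)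
    (hv' : v' ≠ v) (hσv' : ∀ y ∈ v'.asIdeal, σ y ∈ v.asIdeal)
    (hnorm : ∀ a : 𝓞 K, ((Ideal.absNorm (Ideal.span {a}) : ℕ) : 𝓞 K) = a * σ a) :
    ∃ α₁ α₂ : 𝓞 K, α₁ ≠ 0 ∧ α₂ ≠ 0 ∧ α₁ - 1 ∈ 𝔪 ∧ α₂ - 1 ∈ 𝔪 ∧
      IsCoprime (Ideal.span {α₁}) (𝔪 * v.asIdeal) ∧ IsCoprime (Ideal.span {α₂}) (𝔪 * v.asIdeal) ∧
      α₁ - 1 ∈ v.asIdeal ^ (1 + 1) ∧ α₁ - 1 ∉ v.asIdeal ^ (1 + 2) ∧ α₂ - 1 ∈ v.asIdeal ^ (1 + 1) ∧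
      (∀ k : ℕ, 0 < k → ((α₂ : K) : v.adicCompletion K) ^ k ≠ ((α₁ : K) : v.adicCompletion K) ^ k) ∧
      2 ≤ Ideal.absNorm (Ideal.span {α₁}) ∧ 4 ∣ Ideal.absNorm (Ideal.span {α₁}) - 1 ∧
      Ideal.absNorm (Ideal.span {α₂}) = Ideal.absNorm (Ideal.span {α₁}) := by
  obtain ⟨x, hx𝔪, hxv', hxv2, hxv3⟩ := exists_mem_mem_sq_not_mem_cube hv hv'
  -- `σ x ∈ v³`
  have hσx : σ x ∈ v.asIdeal ^ 3 := by
    have h1 : Ideal.map σ v'.asIdeal ≤ v.asIdeal := Ideal.map_le_iff_le_comap.mpr fun y hy ↦ hσv' y hy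
    have h2 := Ideal.mem_map_of_mem (σ : 𝓞 K →+* 𝓞 K) hxv'
    rw [Ideal.map_pow] at h2
    exact Ideal.pow_right_mono h1 3 h2
  have hσx2 : σ x ∈ v.asIdeal ^ 2 := Ideal.pow_le_pow_right (by norm_num) hσx
  set α₁ : 𝓞 K := 1 + x with hα₁
  set α₂ : 𝓞 K := σ α₁ with hα₂
  have hα₂' : α₂ = 1 + σ x := by rw [hα₂, hα₁, map_add, map_one]
  have h1 : α₁ - 1 = x := by rw [hα₁]; ring
  have h2 : α₂ - 1 = σ x := by rw [hα₂']; ring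
  -- non-vanishing and non-unit
  have hv1 : (1 : 𝓞 K) ∉ v.asIdeal := fun h ↦ v.isPrime.ne_top ((Ideal.eq_top_iff_one _).mpr h)
  have hα₁0 : α₁ ≠ 0 := by
    intro h
    have : x = -1 := by rw [hα₁] at h; linear_combination h
    exact hv1 (by simpa [this] using (v.asIdeal.neg_mem (Ideal.pow_le_self two_ne_zero hxv2)))
  have hα₂0 : α₂ ≠ 0 := by rw [hα₂]; exact (map_ne_zero_iff _ σ.injective).mpr hα₁0
  have hN0 : Ideal.absNorm (Ideal.span {α₁}) ≠ 0 := by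
    rw [Ne, Ideal.absNorm_eq_zero_iff, Ideal.span_singleton_eq_bot]; exact hα₁0
  have hN1 : Ideal.absNorm (Ideal.span {α₁}) ≠ 1 := by
    rw [Ne, Ideal.absNorm_eq_one_iff, Ideal.span_singleton_eq_top]
    intro hu
    have := hw hu.unit (by rw [IsUnit.unit_spec, h1]; exact hx𝔪)
    have hx0 : x = 0 := by
      have h' : (hu.unit : 𝓞 K) = 1 := by rw [this, Units.val_one]
      rw [IsUnit.unit_spec, hα₁] at h'; linear_combination h'
    exact hxv3 (by rw [hx0]; exact Submodule.zero_mem _)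
  -- the norms
  have hNeq : Ideal.absNorm (Ideal.span {α₂}) = Ideal.absNorm (Ideal.span {α₁}) := by
    have h := hnorm α₂
    rw [hα₂, hσσ, mul_comm, ← hα₂, ← hnorm α₁] at h
    exact_mod_cast h
  have h4 : (4 : ℤ) ∣ (Ideal.absNorm (Ideal.span {α₁}) : ℤ) - 1 := by
    apply four_dvd_of_intCast_mem_sq e₂
    have hc : (((Ideal.absNorm (Ideal.span {α₁}) : ℤ) - 1 : ℤ) : 𝓞 K) = α₁ * α₂ - 1 := by
      push_cast; rw [hnorm α₁]
    rw [hc, show α₁ * α₂ - 1 = x + σ x + x * σ x by rw [hα₂', hα₁]; ring]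
    exact Submodule.add_mem _ (Submodule.add_mem _ hxv2 hσx2) (Ideal.mul_mem_left _ _ hσx2)
  refine ⟨α₁, α₂, hα₁0, hα₂0, h1 ▸ hx𝔪, h2 ▸ h𝔪σ x hx𝔪,
    (isCoprime_span_singleton_of_sub_one_mem (h1 ▸ hx𝔪)).mul_right
      (isCoprime_span_singleton_of_sub_one_mem (h1 ▸ Ideal.pow_le_self two_ne_zero hxv2)),
    (isCoprime_span_singleton_of_sub_one_mem (h2 ▸ h𝔪σ x hx𝔪)).mul_right
      (isCoprime_span_singleton_of_sub_one_mem (h2 ▸ Ideal.pow_le_self two_ne_zero hσx2)),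
    h1 ▸ hxv2, h1 ▸ hxv3, h2 ▸ hσx2, fun k hk heq ↦ ?_, by omega, ?_, hNeq⟩
  · -- `α₂ᵏ = α₁ᵏ` in `K_v` ⟹ `e(α₂)ᵏ = e(α₁)ᵏ` in `ℤ₂`, against §1
    have hk' := toPadicInt_pow_eq_of_coe_pow_eq e₂ heq
    refine pow_ne_pow_of_two_adic (a := ((e₂ : v.adicCompletionIntegers K →+* ℤ_[2]).comp
      (algebraMap (𝓞 K) (v.adicCompletionIntegers K))) α₁) (b := ((e₂ : v.adicCompletionIntegers K →+* ℤ_[2]).comp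
      (algebraMap (𝓞 K) (v.adicCompletionIntegers K))) α₂) ?_ ?_ ?_ hk hk'.symm
    · rw [← map_one ((e₂ : v.adicCompletionIntegers K →+* ℤ_[2]).comp (algebraMap (𝓞 K) (v.adicCompletionIntegers K))),
        ← map_sub, ← mem_pow_iff_two_pow_dvd_toPadicInt e₂, h1]; exact hxv2
    · rw [← map_one ((e₂ : v.adicCompletionIntegers K →+* ℤ_[2]).comp (algebraMap (𝓞 K) (v.adicCompletionIntegers K))),
        ← map_sub, ← mem_pow_iff_two_pow_dvd_toPadicInt e₂, h1]; exact hxv3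
    · rw [← map_one ((e₂ : v.adicCompletionIntegers K →+* ℤ_[2]).comp (algebraMap (𝓞 K) (v.adicCompletionIntegers K))),
        ← map_sub, ← mem_pow_iff_two_pow_dvd_toPadicInt e₂, h2]; exact hσx
  · -- `4 ∣ N − 1` in `ℕ`
    have hN1' : 1 ≤ Ideal.absNorm (Ideal.span {α₁}) := Nat.one_le_iff_ne_zero.mpr hN0
    have h4' : ((4 : ℕ) : ℤ) ∣ ((Ideal.absNorm (Ideal.span {α₁}) - 1 : ℕ) : ℤ) := by
      rw [Nat.cast_sub hN1', Nat.cast_one]; exact_mod_cast h4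
    exact Int.natCast_dvd_natCast.mp h4'

end Twists

end Summit.BirchSwinnertonDyer.BirchSwinnertonDyer.Theorems.PrintCf2.EllipticUnitsLocal

end
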